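import Summits.QuantumFields.BalabanUV.T4Continuum.Support.NE7K1LinStripClassKL
import Summits.QuantumFields.BalabanUV.T4Continuum.Support.NE7K1LinTorusSymbolBloch

/-!
# NE7K1LinStripClassLine — row NE7 (node U5), candidate route HOM, path H1L, cell K1-lin(s): NEEDS-ESTIMATE #E1, R-E1 TRANCHE B —
# THE TWO-CUTOFF LINE'S SYMBOL `σ_s^{(n)} = (1−s)Δ^ξ_n + s·n²kLfold_L(·∕n)` IS IN THE CLASS `S` FOR EVERY `s ∈ [0,1]`, EVERY MESH
# `n ≥ 1` AND EVERY `L ≥ 1`, WITH `s`-, `n`-, `L`-FREE CONSTANTS; HENCE THE REGROUPED DENOMINATOR OF THE LINE HAS ONE ZERO-FREE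
# STRIP `c_S(d,a₋) ≤ ‖ES n σ_s^{(n)} a p‖`, `p ∈ Strip d κ_line(d,a₋,a₊)`, UNIFORMLY IN `s, n, L, a ∈ [a₋,a₊]`; AND THE DOCKING
# IDENTITY: `σ_s^{(n)}` at the centred dual momenta of the doubled torus IS the torus line's symbol `torSymb … s … p` (file 59)

Lineage `b2b-balaban-t4-ne7-p2` (CRUX PROVER NE7 #2), generation 76; file 66.  Files 62–65: the class, the uniform strip over it,
convexity, `Δ^ξ_n + m² ∈ S`, `n²kLfold_L(·∕n) ∈ S`.  THIS FILE ([folklore]):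

* §1 **`lineSymb L n s`** `= (1−s)·DeltaXi n 0 + s·scaledKL L n` and **`symbS_line`**: for `0 ≤ s ≤ 1`, every `n ≥ 1`, `L ≥ 1`,
  `lineSymb L n s ∈ S(n; r_K(d), C_line(d), U_line(d))` with `C_line = max(25∕16, C_K(d))`, `U_line = max(16d, 16d∕c_F(d))` — by
  `symbS_segment` (file 64) on `symbS_DeltaXi` + `symbS_scaledKL`; the constants are functions of `d` ALONE.
* §2 **`uniformStrip_line`** — R-E1 TRANCHE B HEADLINE: for `0 < a₋ ≤ a ≤ a₊`, EVERY `s ∈ [0,1]`, EVERY `n ≥ 1`, EVERY `L ≥ 1`: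
  `cS d a₋ ≤ ‖ES n (lineSymb L n s) a p‖` on `Strip d (kappaLine d a₋ a₊)`, `kappaLine d a₋ a₊ = κ_S(d, a₋, a₊, U_line(d), r_K(d)) > 0`
  — the zero-free strip of the two-cutoff line's regrouped denominator is ONE strip for the whole `s`-family, every mesh and every
  blocking factor (PRICING-NE7 v34 §248 (d) (k1): no dependence on the torus `M` or on the level `n`; (k2): every `s`, not `s = 1`
  quoted); packaged `line_strip_data` (`ES ≠ 0`, two-sided bounds, holomorphy).
* §3 DOCKING (k2)∕(k3): **`lineSymb_ofReal_zone`** — on real momenta `nθ` with `|θ_μ| ≤ π`,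
  `lineSymb L n s (nθ) = n²[(1−s)Δ¹(θ) + s·k_L(θ)]` (`DeltaXir_eq_scaled`, `kLfold_eq_kL` on the CLOSED zone, `kL_ofReal`); and
  **`lineSymb_eq_torSymb`** — for the doubled torus of files 36–61 (`P_μ = 2nM_μ`), every CENTRED dual index `2|p_μ| ≤ P_μ`, every real
  `s`: `lineSymb L n s (n·θ(p)) = torSymb hn M s y₀ p` BY `torSymb_eq_ofReal` (file 59, THEOREM I's corollary) — the symbol the class
  engine is run on IS the finite-torus symbol of the two-cutoff line, for every `s`, through the centred representative.

HONEST FRAMING: [folklore] assembly; the estimates are files 47–55's (gen 74) and b04's, the identity is file 59's (gen 75); what is NEW is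
only that they meet the hypothesis list of ONE engine with ONE set of constants.  This is the INPUT side of R-E1 (the class-S strip
engine's denominator is zero-free on a uniform strip along the whole line); the multiplier sums (2.48)∕(2.51) over S, the lattice-kernel
decay and the torus periodisation (b04's `B4StripSums` ∕ `B4Torus248Decay` over S) are tranche C; the `∂^ξ` ∕ Hölder parts tranche D.
Nothing of Bałaban's asserted; no `sorry`.  Census only; NE7 NOT PRINTED ∕ NOT PROVED; spine 0∕9; FIXED FINITE T⁴, rung (B)+1; NOT infinite
volume, NOT mass gap, NOT Clay.  HONEST DEPENDENCY: continuum YM on T⁴ ⇐ BetaPertH ∧ nine spine estimates (0/9 proved); BetaPertH ⇐ (D1) ∧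
(D4) ∧ CAP+tail; G-an2-4 gates asym, D1 and NE2/3/4.
-/

noncomputable section

open Finset Complex Set

namespace Summit.QuantumFields.BalabanUV.T4Continuum.NE7K1LinStripClassLine

open Literature.MathematicalPhysics.QuantumFieldTheory.Balaban1983to89
open Literature.MathematicalPhysics.QuantumFieldTheory.Balaban1983to89.B4Strip
open Literature.MathematicalPhysics.QuantumFieldTheory.Balaban1983to89.B4StripCauchy
open NE7K1LinStripClass NE7K1LinStripClassCauchy NE7K1LinStripClassNN NE7K1LinStripClassKLConsts NE7K1LinStripClassKL
open NE7K1LinBlochDenominator NE7K1LinBlochDenominatorFat NE7K1LinBlochSymbolScaled NE7K1LinBlochSymbolFold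

variable {d : ℕ}

/-! ### §1 The line's symbol is in the class, `s`-uniformly -/

/-- **THE TWO-CUTOFF LINE'S LAPLACIAN SYMBOL ON THE `ξ = 1∕n` LATTICE**: `σ_s^{(n)}(q) = (1−s)·Δ^ξ_n(q) + s·n²·kLfold_L(q∕n)` —
run A's block Laplacian interpolated with run B's hard block-mean Schur complement (the symbol of `(1−s)(−Δ^ξ) + s·K_L^ξ`; at the dual
momenta of the doubled torus it is file 59's `torSymb`, §3). [folklore] -/
def lineSymb (L : ℕ) [NeZero L] (n : ℕ) (s : ℝ) (q : Fin d → ℂ) : ℂ := (1 - s) * DeltaXi n 0 q + s * scaledKL L n q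

/-- the line's floor constant `C_line(d) = max(25∕16, C_K(d))`. [folklore] -/
def CSline (d : ℕ) : ℝ := max (25 / 16) (CK d)

/-- the line's fat bound `U_line(d) = max(16d, 16d∕c_F(d))`. [folklore] -/
def CupLine (d : ℕ) : ℝ := max (16 * d) (CupK d)

/-- `U_line ≥ 0`. [folklore] -/
theorem CupLine_nonneg (d : ℕ) : 0 ≤ CupLine d := le_max_of_le_right (CupK_nonneg d)

/-- b04's massless block Laplacian at the line's radius: `Δ^ξ_n ∈ S(n; r_K(d), 25∕16, 16d)`. [folklore] -/
theorem symbS_DeltaXi_rK (n : ℕ) [NeZero n] : SymbS n (DeltaXi (d := d) n 0) (rK d) (25 / 16) (16 * d) := by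
  obtain ⟨hr4, _, _, _, _, h25⟩ := rK_facts d
  have h := symbS_DeltaXi (d := d) n 0 le_rfl (rK_pos d) hr4 h25
  simpa using h

/-- **THE LINE'S SYMBOL IS IN THE CLASS FOR EVERY `s ∈ [0,1]`**, every mesh `n ≥ 1`, every `L ≥ 1`, with constants
`(r_K(d), C_line(d), U_line(d))` depending on `d` ALONE. [folklore] -/
theorem symbS_line (L : ℕ) [NeZero L] (n : ℕ) [NeZero n] {s : ℝ} (hs0 : 0 ≤ s) (hs1 : s ≤ 1) :
    SymbS n (lineSymb (d := d) L n s) (rK d) (CSline d) (CupLine d) :=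
  symbS_segment (symbS_DeltaXi_rK n) (symbS_scaledKL L n) hs0 hs1

/-! ### §2 R-E1 tranche B: one zero-free strip for the whole line -/

/-- THE LINE'S STRIP HALF-WIDTH `κ_line(d, a₋, a₊) = κ_S(d, a₋, a₊, U_line(d), r_K(d))` — free of `s`, `n`, `L`. [folklore] -/
def kappaLine (d : ℕ) (aminus aplus : ℝ) : ℝ := kappaS d aminus aplus (CupLine d) (rK d)

/-- `κ_line > 0`. [folklore] -/
theorem kappaLine_pos (d : ℕ) {aminus : ℝ} (aplus : ℝ) (ha : 0 < aminus) : 0 < kappaLine d aminus aplus :=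
  kappaS_pos d ha (CupLine_nonneg d) (rK_pos d)

/-- `κ_line ≤ r_K`. [folklore] -/
theorem kappaLine_le (d : ℕ) (aminus aplus : ℝ) : kappaLine d aminus aplus ≤ rK d := kappaS_le d _ _ _ _

/-- **R-E1 TRANCHE B — THE UNIFORM ZERO-FREE STRIP OF THE TWO-CUTOFF LINE'S REGROUPED DENOMINATOR**: for `0 < a₋ ≤ a ≤ a₊`, EVERY
`s ∈ [0,1]`, EVERY mesh `n ≥ 1` and EVERY blocking factor `L ≥ 1`:
`c_S(d, a₋) ≤ ‖ES n σ_s^{(n)} a p‖` for all `p ∈ Strip d κ_line(d, a₋, a₊)` — the constants depend on `(d, a₋, a₊)` ONLY. [folklore] -/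
theorem uniformStrip_line (L : ℕ) [NeZero L] (n : ℕ) [NeZero n] {s : ℝ} (hs0 : 0 ≤ s) (hs1 : s ≤ 1) {aminus aplus a : ℝ}
    (ha : 0 < aminus) (ha1 : aminus ≤ a) (ha2 : a ≤ aplus) :
    ∀ p ∈ Strip d (kappaLine d aminus aplus), cS d aminus ≤ ‖ES n (lineSymb L n s) a p‖ :=
  uniformStrip (symbS_line L n hs0 hs1) ha ha1 ha2

/-- packaged strip data of the line (`ES ≠ 0`, two-sided bounds, joint holomorphy) on `Strip d κ_line`, uniformly in `s, n, L, a`. [folklore] -/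
theorem line_strip_data (L : ℕ) [NeZero L] (n : ℕ) [NeZero n] {s : ℝ} (hs0 : 0 ≤ s) (hs1 : s ≤ 1) {aminus aplus a : ℝ}
    (ha : 0 < aminus) (ha1 : aminus ≤ a) (ha2 : a ≤ aplus) {p : Fin d → ℂ} (hp : p ∈ Strip d (kappaLine d aminus aplus)) :
    ES n (lineSymb L n s) a p ≠ 0 ∧ cS d aminus ≤ ‖ES n (lineSymb L n s) a p‖ ∧
      ‖ES n (lineSymb L n s) a p‖ ≤ boundMS d (max |aminus| |aplus|) (CupLine d) ∧
      DifferentiableAt ℂ (ES n (lineSymb L n s) a) p :=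
  strip_data (symbS_line L n hs0 hs1) ha ha1 ha2 hp

/-- the line's strip lies in the fat region `Fat d r_K`. [folklore] -/
theorem strip_line_subset_fat (aminus aplus : ℝ) : Strip d (kappaLine d aminus aplus) ⊆ Fat d (rK d) :=
  B4StripCauchy.strip_subset_fat (rK_pos d).le (kappaLine_le d aminus aplus)

/-! ### §3 Docking: the class symbol IS the torus line's symbol at the centred dual momenta -/

/-- scaling a real vector: `(nθ)∕n = θ`. [folklore] -/
theorem sclV_ofRealVec_mul {n : ℕ} (hn : 1 ≤ n) (θ : Fin d → ℝ) :
    sclV n (ofRealVec (fun μ => (n : ℝ) * θ μ)) = ofRealVec θ := by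
  have hn' : (n : ℂ) ≠ 0 := Nat.cast_ne_zero.mpr (by omega)
  funext μ
  simp only [sclV, ofRealVec]
  push_cast
  field_simp

/-- **THE LINE'S SYMBOL ON THE REAL ZONE**: for `|θ_μ| ≤ π`, every `n ≥ 1`, every real `s`,
`σ_s^{(n)}(nθ) = n²·[(1−s)·Δ¹(θ) + s·k_L(θ)]` (the fold is the identity on the closed zone). [folklore] -/
theorem lineSymb_ofReal_zone (L : ℕ) [NeZero L] {n : ℕ} (hn : 1 ≤ n) (s : ℝ) {θ : Fin d → ℝ} (hθ : ∀ μ, |θ μ| ≤ Real.pi) :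
    lineSymb L n s (ofRealVec (fun μ => (n : ℝ) * θ μ))
      = (((n : ℝ) ^ 2 * ((1 - s) * Delta1r 0 θ + s * kLr L θ) : ℝ) : ℂ) := by
  have hn0 : (0 : ℝ) < n := by exact_mod_cast (show 0 < n by omega)
  -- the NN part
  have hΔ : DeltaXi n 0 (ofRealVec (fun μ => (n : ℝ) * θ μ)) = (((n : ℝ) ^ 2 * Delta1r 0 θ : ℝ) : ℂ) := by
    rw [DeltaXi_ofReal, DeltaXir_eq_scaled]
    congr 3
    funext μ; field_simp
  -- the block-mean part: fold is the identity on the closed zone, then reality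
  have hfold : kLfold L (ofRealVec θ) = kL L (ofRealVec θ) := by
    refine kLfold_eq_kL L (κ := 0) (by norm_num) (by norm_num) (fun ν => ?_) (fun ν => ?_)
    · simp [ofRealVec]
    · have := hθ ν
      simp only [ofRealVec, Complex.ofReal_re]
      exact abs_le.mp this
  have hK : scaledKL L n (ofRealVec (fun μ => (n : ℝ) * θ μ)) = (((n : ℝ) ^ 2 * kLr L θ : ℝ) : ℂ) := by
    unfold scaledKL
    rw [sclV_ofRealVec_mul hn, hfold, kL_ofReal]
    push_cast; ring
  unfold lineSymb
  rw [hΔ, hK]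
  push_cast; ring

open NE7K1LinFoldKernels (dbl dbl_pos) in
open NE7K1LinFoldMatrices (mul_pos_side) in
open NE7K1LinTorusFineWaves (thetaOf) in
open NE7K1LinTorusLineSymbol (torSymb) in
open NE7K1LinTorusSymbolBloch (torSymb_eq_ofReal abs_thetaOf_le_pi) in
open Literature.MathematicalPhysics.QuantumFieldTheory.Balaban1983to89.B4Reflection242 (boxDom) in
/-- **DOCKING IDENTITY (every `s`, centred representative)**: on the doubled torus of files 36–61 (`P_μ = 2nM_μ` fine sites), for
every CENTRED dual index `2|p_μ| ≤ P_μ` and every real `s`, the class symbol at the real momentum `n·θ(p)` (`θ(p)_μ = 2πp_μ∕P_μ ∈ [−π,π]`)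
IS the finite-torus symbol of the two-cutoff line: `σ_s^{(n)}(n·θ(p)) = torSymb hn M s y₀ p` — by `torSymb_eq_ofReal` (THEOREM I's
all-`s` corollary, file 59) and §3's zone formula.  The strip engine of tranche C therefore runs on the torus line's own symbol, for
every `s`, through the centred representative (PRICING-NE7 v34 §248 (d) (k2)∕(k3)). [folklore] -/
theorem lineSymb_eq_torSymb {n L : ℕ} [NeZero L] {M : Fin (d + 1) → ℕ} (hn : 1 ≤ n) (hM : ∀ i, 1 ≤ M i)
    (y₀ : ↥(boxDom (dbl fun i => n * M i))) {p : Fin (d + 1) → ℤ} (hp : ∀ μ, 2 * |p μ| ≤ (dbl (fun i => n * M i) μ : ℤ))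
    (s : ℝ) :
    lineSymb L n s (ofRealVec (fun μ => (n : ℝ) * thetaOf (dbl fun i => n * M i) p μ)) = torSymb (L := L) hn M s y₀ p := by
  have hPc : ∀ i, 1 ≤ dbl (fun i => n * M i) i := dbl_pos (mul_pos_side hn hM)
  have hp' : ∀ μ, |p μ| < (dbl (fun i => n * M i) μ : ℤ) := by
    intro μ
    have h1 := hp μ
    have h2 : (1 : ℤ) ≤ (dbl (fun i => n * M i) μ : ℤ) := by exact_mod_cast hPc μ
    have h3 := abs_nonneg (p μ)
    omega
  rw [torSymb_eq_ofReal hn hM y₀ hp' s, lineSymb_ofReal_zone L hn s (abs_thetaOf_le_pi hPc hp)]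

end Summit.QuantumFields.BalabanUV.T4Continuum.NE7K1LinStripClassLine

end
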